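import Literature.NumberTheory.LFunctions.RiemannSiegelIntegralFormula
import Literature.NumberTheory.LFunctions.ZetaArgVariation
import Literature.NumberTheory.LFunctions.RiemannSiegelPhase
import Literature.Analysis.Complex.PolyDerivOperator
import HarnessLib

/-!
# Conrey's auxiliary functions `Q = H·V` of Levinson's method and the identity `c·Λ(s) = Q(s) + conj Q(1 − s̄)`

Topic `Literature/NumberTheory/LFunctions`. J. B. Conrey, *Zeros of derivatives of Riemann's
ξ-function on the critical line*, J. Number Theory 16 (1983), §4 ("An identity for `ξ⁽ᵐ⁾(s)`"),
case `m = 0`: let `φ` be a real polynomial with `φ(x) + φ(1 − x) = c` and put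
`c(z) = φ(L⁻¹ log z)`, `d(z) = φ(1 − L⁻¹ log z)`. From Siegel's exact integral formula (Conrey's
Lemma 3; in the tree `Literature.NumberTheory.LFunctions.SiegelIntegral.riemannZeta_eq_riemannAux_add`:
`ζ(s) = 𝓡(s) + χ(s) K(s)`, `K(s) = conj 𝓡(1 − s̄)`, on `0 < σ < 3`, `s ≠ 1`), Conrey writes

  `K ξ(s) = Q(s) + conj Q(1 − s̄)`,  `Q(s) = H(s) ∫ c(z) z^{−s} (…) dz + H(1−s) ∫ d(z) z^{s−1} (…) dz`   (1)

and `Q = H·V`. Since `(−d/ds) z^{−s} = (log z) z^{−s}` and `(d/ds) z^{s−1} = (log z) z^{s−1}`,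
inserting `c(z)`, `d(z)` under Siegel's integrals is applying the differential operators
`φ(−L⁻¹ d/ds)` to `𝓡` and `φ(1 − L⁻¹ d/ds)` to `K` (`Literature.Analysis.Complex.polyDerivOp`). With
`H = Γℝ` (`Γℝ(s) = π^{−s/2} Γ(s/2)`, so that `H ζ = Λ` is Mathlib's `completedRiemannZeta`) we
therefore *define*

  `conreyQ φ L s = Γℝ(s) · (φ(−L⁻¹δ) 𝓡)(s) + Γℝ(1 − s) · ((φ ∘ (1 − X))(L⁻¹δ) K)(s)`,
  `conreyV φ L s = (φ(−L⁻¹δ) 𝓡)(s) + χ(s) · ((φ ∘ (1 − X))(L⁻¹δ) K)(s)`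

and prove (1): **`conreyQ φ L s + conj (conreyQ φ L (1 − s̄)) = c · (Γℝ(s) 𝓡(s) + Γℝ(1−s) K(s))`**
for *all* `s` (`conreyQ_add_conj_one_sub_conj`; the reflection rule
`Literature.Analysis.Complex.conj_polyDerivOp_one_sub_conj` turns `φ(−δ/L)` into `φ(δ/L)` and
`(φ∘(1−X))(δ/L)` into `(φ∘(1−X))(−δ/L) = φ(1 + δ/L)`, and `φ(X) + φ(1−X) = c` as operators gives
`c`), which equals **`c · Λ(s) = c · Γℝ(s) ζ(s)`** on `0 < σ < 3`, `s ≠ 1`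
(`conreyQ_add_conj_one_sub_conj_eq`), together with `conreyQ = Γℝ · conreyV` on `σ > 0`
(`conreyQ_eq_Gammaℝ_mul_conreyV`, via `Γℝ(s) χ(s) = Γℝ(1 − s)`), and the analyticity of `conreyQ`,
`conreyV` on `{0 < σ < 3} ∖ {1}`.

So on the critical line `c·Λ(½+it) = 2 Re conreyQ(½+it)`: the zeros of `ζ` on the line are read
off from the argument of `Q = Γℝ·V` (the tree's generic
`Literature.Analysis.Complex.levinsonConrey_zeroDetection`).

## References

* J. B. Conrey, *Zeros of derivatives of Riemann's ξ-function on the critical line*, J. Number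
  Theory 16 (1983), 49–74, §3 Lemma 3, §4 (1). [Conrey1983]
* C. L. Siegel, *Über Riemanns Nachlaß zur analytischen Zahlentheorie* (1932), §3 (56)–(58).
-/

noncomputable section

open Complex Polynomial Set Filter Topology
open scoped Real ComplexConjugate

namespace Literature.NumberTheory.LFunctions

open Literature.Analysis.Complex SiegelIntegral

/-! ## `Γℝ` under conjugation and the factor `χ` -/

/-- **`Γℝ(s) χ(s) = Γℝ(1 − s)` for `Re s > 0`** (`χ = rsChi`, the factor of `ζ(s) = χ(s) ζ(1−s)`; from
Mathlib's `Γℝ(s)/Γℝ(1−s) = Γℂ(s) cos(πs/2)`; at the odd integers `s = 2n+1` both sides are `0` by the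
junk conventions). [cite: Titchmarsh1986, §2.1 (2.1.8)–(2.1.10)] -/
theorem Gammaℝ_mul_rsChi {s : ℂ} (hs : 0 < s.re) : Gammaℝ s * rsChi s = Gammaℝ (1 - s) := by
  have hodd : ∀ n : ℕ, s ≠ -(2 * n + 1) := by
    intro n h
    have := congrArg Complex.re h
    simp at this
    linarith [n.cast_nonneg (α := ℝ)]
  have hG : Gammaℝ s ≠ 0 := Gammaℝ_ne_zero_of_re_pos hs
  have hfe : ZetaM4.feFactor s = Gammaℝ s / Gammaℝ (1 - s) := by
    rw [Gammaℝ_div_Gammaℝ_one_sub hodd, Gammaℂ_def, ZetaM4.feFactor]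
  rw [rsChi_eq_inv_feFactor, hfe, inv_div, mul_div_cancel₀ _ hG]

/-! ## Conrey's `Q` and `V` -/

/-- **Conrey's `Q`** (J. Number Theory 16 (1983), §4, (1), `m = 0`, with `H = Γℝ`): for a real
polynomial `φ` and `L > 0`,
`conreyQ φ L s = Γℝ(s) · (φ(−L⁻¹ d/ds) 𝓡)(s) + Γℝ(1−s) · ((φ∘(1−X))(L⁻¹ d/ds) K)(s)`,
`𝓡` Riemann's auxiliary function and `K(s) = conj 𝓡(1 − s̄)` (Siegel's integrals with the weights
`φ(L⁻¹ log z)`, `φ(1 − L⁻¹ log z)` inserted). [cite: Conrey1983, §4 (1)] -/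
def conreyQ (φ : ℝ[X]) (L : ℝ) (s : ℂ) : ℂ :=
  Gammaℝ s * polyDerivOp φ (-L⁻¹) riemannAux s +
    Gammaℝ (1 - s) * polyDerivOp (φ.comp (1 - X)) L⁻¹ riemannAuxConj s

/-- **Conrey's `V = Q/H`** (loc. cit.: "where `V(s) = Q(s)/H(s)`"; his Lemma 4 then gives
`V = C + χ D + O(T^{−1/4})` with the Dirichlet polynomials `C`, `D`):
`conreyV φ L s = (φ(−L⁻¹ d/ds) 𝓡)(s) + χ(s) · ((φ∘(1−X))(L⁻¹ d/ds) K)(s)`. [cite: Conrey1983, §4 (2)] -/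
def conreyV (φ : ℝ[X]) (L : ℝ) (s : ℂ) : ℂ :=
  polyDerivOp φ (-L⁻¹) riemannAux s + rsChi s * polyDerivOp (φ.comp (1 - X)) L⁻¹ riemannAuxConj s

/-- `Q = Γℝ · V` on `Re s > 0`. [cite: Conrey1983, §4 (2)] -/
theorem conreyQ_eq_Gammaℝ_mul_conreyV (φ : ℝ[X]) (L : ℝ) {s : ℂ} (hs : 0 < s.re) :
    conreyQ φ L s = Gammaℝ s * conreyV φ L s := by
  rw [conreyQ, conreyV, mul_add, ← mul_assoc, Gammaℝ_mul_rsChi hs]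

/-- `K♯ = 𝓡`: `conj K(1 − s̄) = 𝓡(s)` (by the definition `K(s) = conj 𝓡(1 − s̄)`). [folklore] -/
theorem conj_riemannAuxConj_one_sub_conj (s : ℂ) : conj (riemannAuxConj (1 - conj s)) = riemannAux s := by
  simp [riemannAuxConj]

/-- **Conrey's identity (1)**, operator form: if `φ + φ∘(1−X) = c` then for every `s`,
`conreyQ φ L s + conj (conreyQ φ L (1 − s̄)) = c · (Γℝ(s) 𝓡(s) + Γℝ(1−s) K(s))`.
[cite: Conrey1983, §4 (1)] -/
theorem conreyQ_add_conj_one_sub_conj {φ : ℝ[X]} {c : ℝ} (hφ : φ + φ.comp (1 - X) = C c)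
    (L : ℝ) (s : ℂ) :
    conreyQ φ L s + conj (conreyQ φ L (1 - conj s)) =
      c * (Gammaℝ s * riemannAux s + Gammaℝ (1 - s) * riemannAuxConj s) := by
  have hR : Differentiable ℂ riemannAux := differentiable_riemannAux
  have hK : Differentiable ℂ riemannAuxConj := differentiable_riemannAuxConj
  -- the reflected pieces
  have hA : conj (polyDerivOp φ (-L⁻¹) riemannAux (1 - conj s)) = polyDerivOp φ L⁻¹ riemannAuxConj s := by
    rw [conj_polyDerivOp_one_sub_conj φ _ hR s, neg_neg]
    rfl
  have hB : conj (polyDerivOp (φ.comp (1 - X)) L⁻¹ riemannAuxConj (1 - conj s)) =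
      polyDerivOp (φ.comp (1 - X)) (-L⁻¹) riemannAux s := by
    rw [conj_polyDerivOp_one_sub_conj _ _ hK s]
    congr 1
    funext w
    exact conj_riemannAuxConj_one_sub_conj w
  have hG1 : conj (Gammaℝ (1 - conj s)) = Gammaℝ (1 - s) := by
    rw [← Gammaℝ_conj]; simp
  have hG2 : conj (Gammaℝ (1 - (1 - conj s))) = Gammaℝ s := by
    rw [← Gammaℝ_conj]; simp
  have hφ' : φ.comp (1 - X) + φ = C c := by rw [add_comm]; exact hφ
  rw [conreyQ, conreyQ, map_add, map_mul, map_mul, hA, hB, hG1, hG2]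
  calc Gammaℝ s * polyDerivOp φ (-L⁻¹) riemannAux s +
        Gammaℝ (1 - s) * polyDerivOp (φ.comp (1 - X)) L⁻¹ riemannAuxConj s +
        (Gammaℝ (1 - s) * polyDerivOp φ L⁻¹ riemannAuxConj s +
          Gammaℝ s * polyDerivOp (φ.comp (1 - X)) (-L⁻¹) riemannAux s)
      = Gammaℝ s * polyDerivOp (φ + φ.comp (1 - X)) (-L⁻¹) riemannAux s +
          Gammaℝ (1 - s) * polyDerivOp (φ.comp (1 - X) + φ) L⁻¹ riemannAuxConj s := by
        rw [polyDerivOp_add, polyDerivOp_add]; ring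
    _ = c * (Gammaℝ s * riemannAux s + Gammaℝ (1 - s) * riemannAuxConj s) := by
        rw [hφ, hφ', polyDerivOp_C, polyDerivOp_C]; ring

/-- **Conrey's identity (1)**: if `φ + φ∘(1−X) = c` then for `0 < Re s < 3`, `s ≠ 1`,
`conreyQ φ L s + conj (conreyQ φ L (1 − s̄)) = c · Γℝ(s) ζ(s)` (Siegel's integral formula
`ζ = 𝓡 + χ K` and `Γℝ χ = Γℝ(1 − ·)`). In particular on the critical line
`c Γℝ(½+it) ζ(½+it) = 2 Re conreyQ(½+it)`. [cite: Conrey1983, §4 (1)] -/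
theorem conreyQ_add_conj_one_sub_conj_eq {φ : ℝ[X]} {c : ℝ} (hφ : φ + φ.comp (1 - X) = C c)
    (L : ℝ) {s : ℂ} (hs0 : 0 < s.re) (hs3 : s.re < 3) (hs1 : s ≠ 1) :
    conreyQ φ L s + conj (conreyQ φ L (1 - conj s)) = c * (Gammaℝ s * riemannZeta s) := by
  rw [conreyQ_add_conj_one_sub_conj hφ, riemannZeta_eq_riemannAux_add hs0 hs3 hs1,
    ← Gammaℝ_mul_rsChi hs0]
  ring

/-- The same with Mathlib's completed zeta function: `… = c · Λ(s)`, `Λ = completedRiemannZeta`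
(`ζ(s) = Λ(s)/Γℝ(s)` for `s ≠ 0`). [cite: Conrey1983, §4 (1)] -/
theorem conreyQ_add_conj_one_sub_conj_eq_completedZeta {φ : ℝ[X]} {c : ℝ}
    (hφ : φ + φ.comp (1 - X) = C c) (L : ℝ) {s : ℂ} (hs0 : 0 < s.re) (hs3 : s.re < 3) (hs1 : s ≠ 1) :
    conreyQ φ L s + conj (conreyQ φ L (1 - conj s)) = c * completedRiemannZeta s := by
  rw [conreyQ_add_conj_one_sub_conj_eq hφ L hs0 hs3 hs1, riemannZeta_def_of_ne_zero (by
    rintro rfl; simp at hs0), mul_div_cancel₀ _ (Gammaℝ_ne_zero_of_re_pos hs0)]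

/-! ## Analyticity -/

/-- The region `{0 < σ < 3} ∖ {1}` is open. [folklore] -/
theorem isOpen_rsRegion : IsOpen {s : ℂ | 0 < s.re ∧ s.re < 3 ∧ s ≠ 1} := by
  have : {s : ℂ | 0 < s.re ∧ s.re < 3 ∧ s ≠ 1} =
      ({s : ℂ | 0 < s.re} ∩ {s : ℂ | s.re < 3}) ∩ {s : ℂ | s ≠ 1} := by
    ext s; simp [and_assoc]
  rw [this]
  exact ((isOpen_lt continuous_const Complex.continuous_re).inter
    (isOpen_lt Complex.continuous_re continuous_const)).inter isOpen_ne

/-- `conreyV φ L` is analytic at every point of `{0 < σ < 3} ∖ {1}`. [cite: Conrey1983, §4] -/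
theorem analyticAt_conreyV (φ : ℝ[X]) (L : ℝ) {s : ℂ} (hs0 : 0 < s.re) (hs3 : s.re < 3) (hs1 : s ≠ 1) :
    AnalyticAt ℂ (conreyV φ L) s := by
  have hd : DifferentiableOn ℂ (conreyV φ L) {s : ℂ | 0 < s.re ∧ s.re < 3 ∧ s ≠ 1} := by
    intro z hz
    refine DifferentiableAt.differentiableWithinAt ?_
    unfold conreyV
    exact (differentiable_polyDerivOp _ _ differentiable_riemannAux z).add
      ((differentiableAt_rsChi hz.1 hz.2.1 hz.2.2).mul
        (differentiable_polyDerivOp _ _ differentiable_riemannAuxConj z))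
  exact hd.analyticAt (isOpen_rsRegion.mem_nhds ⟨hs0, hs3, hs1⟩)

/-- `conreyQ φ L` is analytic at every point of `{0 < σ < 3} ∖ {1}` (there `conreyQ = Γℝ · conreyV`).
[cite: Conrey1983, §4] -/
theorem analyticAt_conreyQ (φ : ℝ[X]) (L : ℝ) {s : ℂ} (hs0 : 0 < s.re) (hs3 : s.re < 3) (hs1 : s ≠ 1) :
    AnalyticAt ℂ (conreyQ φ L) s := by
  have hG : AnalyticAt ℂ Gammaℝ s := analyticAt_Gammaℝ_of_re_pos hs0
  have h := hG.mul (analyticAt_conreyV φ L hs0 hs3 hs1)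
  refine h.congr ?_
  filter_upwards [(isOpen_lt continuous_const Complex.continuous_re).mem_nhds hs0] with z hz
  exact (conreyQ_eq_Gammaℝ_mul_conreyV φ L hz).symm

/-- `conreyQ φ L` is analytic at every point of a closed rectangle `[½, b] × [T₁, T₂]` with
`b < 3` and `0 < T₁` (the rectangles of Levinson's method). [cite: Conrey1983, §4] -/
theorem analyticOnNhd_conreyQ_rect (φ : ℝ[X]) (L : ℝ) {b T₁ T₂ : ℝ} (hb : b < 3) (hT₁ : 0 < T₁) :
    AnalyticOnNhd ℂ (conreyQ φ L) (Icc (1 / 2 : ℝ) b ×ℂ Icc T₁ T₂) := by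
  intro s hs
  obtain ⟨⟨h1, h2⟩, ⟨h3, _⟩⟩ := Complex.mem_reProdIm.1 hs
  refine analyticAt_conreyQ φ L (by linarith) (by linarith) ?_
  rintro rfl
  simp at h3
  linarith

/-- `conreyV φ L` is analytic at every point of a closed rectangle `[½, b] × [T₁, T₂]` with
`b < 3` and `0 < T₁`. [cite: Conrey1983, §4] -/
theorem analyticOnNhd_conreyV_rect (φ : ℝ[X]) (L : ℝ) {b T₁ T₂ : ℝ} (hb : b < 3) (hT₁ : 0 < T₁) :
    AnalyticOnNhd ℂ (conreyV φ L) (Icc (1 / 2 : ℝ) b ×ℂ Icc T₁ T₂) := by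
  intro s hs
  obtain ⟨⟨h1, h2⟩, ⟨h3, _⟩⟩ := Complex.mem_reProdIm.1 hs
  refine analyticAt_conreyV φ L (by linarith) (by linarith) ?_
  rintro rfl
  simp at h3
  linarith

end Literature.NumberTheory.LFunctions

end
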